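import Mathlib
import Literature.MathematicalPhysics.QuantumFieldTheory.BalabanImbrieJaffe1984to88.BIJ85Eq7112FibreMin

/-!
# `BalabanImbrieJaffe1984to88.BIJ85Eq7112FibreMinReal` — T. Bałaban, J. Imbrie, A. Jaffe, *Renormalization of the Higgs model:
minimizers, propagators and the stability of mean field theory*, Commun. Math. Phys. **97** (1985) 299–329 [BalabanImbrieJaffe1985]:
Sect. 4.2 p. 310 (4.2.1) / Sect. 7.1 p. 322 (7.1.12) — **THE CONSTRAINED MINIMISATION OF THE EXPONENT OF (4.2.1) IS A REAL PROBLEM**: the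
three CONCRETE operators `∂^η = n·curlC`, `Q_k = B5Block118.QvOp`, `Q^{e*}_k = edgeAdjC` of the tori have REAL matrix entries, so for a
complex η-bond field `A` and a complex unit two-form `F` the exponent splits, `E(A, F) = E(Re A, Re F) + E(Im A, Im F)`, the constraint
`Q_kA = 0` splits, and **`inf_{Q_kA=0} E(A, F) = inf_{Q_kA=0} E(A, Re F) + inf_{Q_kA=0} E(A, Im F)`** — the bookkeeping that lets file 3
(`BIJ85Eq7112SymbolFibreMin`) test the REAL σ_k of (4.2.1) (*"Here f is any real (Lie algebra) valued field defined on unit lattice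
plaquettes"*, p. 310) against the COMPLEX single-momentum modes of (7.1.2); file 2 of 4 of the (7.1.12) = (7.1.13) identification for the
σ_k of record (file 1 `BIJ85Eq7112FibreMin`: `inf_{Q_kA=0} E(A, f) = Σ_{p′} m_{p′}(f̂(p′))`)

statement-level skeleton of published theorems with citation tags; proofs where landed; nothing here is a claim about
the Yang–Mills mass gap

PDF held: `paper:balaban1985-cmp97-bij-higgs-minimizers` (journal page = PDF page + 298).  Text read as images: PDF p. 12 (journal 310;
`run/shared/lean/pub/pub-balaban/t4/b2b-balaban-t4-lit2/renders/bij1985/1985-cmp97-bij-higgs-minimizers-p012-x2.png`), PDF pp. 23–24.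

THE PRINTED TEXT (verbatim).  p. 310: *"exp(−½⟨f, σ_kf⟩) = Z_{k,Ax}^{−1}∫𝒟Aδ(Q_kA)δ_{k,Ax}(A)exp(−½‖∂A − Q^{e*}_kf‖²). (4.2.1) Here f is any
real (Lie algebra) valued field defined on unit lattice plaquettes."*; p. 322: *"The basic object we wish to study is σ_k, defined in
(4.2.2), σ_k = Q^e_k(I − ∂G_{k,Ax}∂^*)Q^{e*}_k. (7.1.12)"*.

CITATION HEADER (lean-in-tree rule).  Part of the lit-balaban TYPED SKELETON (HOME `run/shared/lean/pub/lit-balaban/`), Phase-2 seat p27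
(gen 6), unit `lit-balaban-p27`; rows **C1.Eq7.1.2-7.1.12**, **C1.Eq4.2.1-4.2.2**, **C1.Thm7.1.1** of `HOME/SKELETON.md` (owner r15, referee
ref-5).  TYPED READING as in file 1 (`energy421 n M A f = η^d·Σ_b|(n·curlC A − edgeAdjC f)(b)|²`); `reP g`, `imP g` = the real and
imaginary parts of a complex field, read back as complex fields.
WHAT IS KERNEL-CHECKED (zero `sorry`, standard axioms; the bookkeeping defs `reP`/`imP` with bodies; no `def … : Prop`, no new named fact,
D-0026): `mulVec_reP`/`mulVec_imP` (a matrix with real entries commutes with taking real/imaginary parts); reality of the three operators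
`curlC_im`, `QvOp_im`, `edgeAvgC_im`, `edgeAdjC_im`; `QvOp_eq_zero_iff_reP_imP` (the constraint splits); **`energy421_eq_reP_add_imP`**;
`energy421_reP_le` (for a real two-form, discarding `Im A` does not raise the exponent); **`iInf_energy421_eq_reP_add_imP`**.
NOT CLAIMED here: anything on the `Setup` carriers (file 3).
-/

namespace Literature.MathematicalPhysics.QuantumFieldTheory.BalabanImbrieJaffe1984to88.BIJ85Eq7112FibreMinReal

open scoped BigOperators Matrix ComplexConjugate
open Literature.MathematicalPhysics.QuantumFieldTheory.Balaban1983to89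
open Literature.MathematicalPhysics.QuantumFieldTheory.Balaban1983to89.B5Prop11Plancherel
open Literature.MathematicalPhysics.QuantumFieldTheory.Balaban1983to89.B5Block118
open Literature.MathematicalPhysics.QuantumFieldTheory.BalabanImbrieJaffe1984to88.BIJ85Eq715ConfigSymbols
open Literature.MathematicalPhysics.QuantumFieldTheory.BalabanImbrieJaffe1984to88.BIJ85Eq7111EdgeAverage
open Literature.MathematicalPhysics.QuantumFieldTheory.BalabanImbrieJaffe1984to88.BIJ85Eq7111EdgeAdjoint
open Literature.MathematicalPhysics.QuantumFieldTheory.BalabanImbrieJaffe1984to88.BIJ85Eq7112FibreMin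

noncomputable section

variable {d : ℕ} (n : ℕ) [NeZero n] (M : Fin d → ℕ) [hM : ∀ μ, NeZero (M μ)]

/-! ## §1 Real and imaginary parts; real matrices -/

/-- The real part of a complex field, as a complex field. [cite: BalabanImbrieJaffe1985, (4.2.1) p.310] -/
def reP {ι : Type*} (g : ι → ℂ) : ι → ℂ := fun i => ((g i).re : ℂ)

/-- The imaginary part of a complex field, as a complex field. [cite: BalabanImbrieJaffe1985, (4.2.1) p.310] -/
def imP {ι : Type*} (g : ι → ℂ) : ι → ℂ := fun i => ((g i).im : ℂ)

/-- `reP` unfolded. [cite: BalabanImbrieJaffe1985, (4.2.1) p.310] -/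
@[simp] theorem reP_apply {ι : Type*} (g : ι → ℂ) (i : ι) : reP g i = ((g i).re : ℂ) := rfl

/-- `imP` unfolded. [cite: BalabanImbrieJaffe1985, (4.2.1) p.310] -/
@[simp] theorem imP_apply {ι : Type*} (g : ι → ℂ) (i : ι) : imP g i = ((g i).im : ℂ) := rfl

/-- `g = Re g + i·Im g`. [cite: BalabanImbrieJaffe1985, (4.2.1) p.310] -/
theorem reP_add_I_smul_imP {ι : Type*} (g : ι → ℂ) : reP g + Complex.I • imP g = g := by
  funext i
  simp only [Pi.add_apply, Pi.smul_apply, reP_apply, imP_apply, smul_eq_mul]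
  rw [mul_comm]
  exact Complex.re_add_im (g i)

/-- A matrix with real entries maps real parts to real parts. [cite: BalabanImbrieJaffe1985, (4.2.1) p.310] -/
theorem mulVec_reP {ι κ : Type*} [Fintype κ] (T : Matrix ι κ ℂ) (hT : ∀ a b, (T a b).im = 0) (g : κ → ℂ) :
    T *ᵥ reP g = reP (T *ᵥ g) := by
  funext a
  simp only [reP_apply, Matrix.mulVec, dotProduct, Complex.re_sum, Complex.ofReal_sum, Complex.mul_re, hT, zero_mul,
    sub_zero, Complex.ofReal_mul]
  refine Finset.sum_congr rfl fun b _ => ?_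
  rw [← Complex.re_add_im (T a b), hT]
  simp

/-- A matrix with real entries maps imaginary parts to imaginary parts. [cite: BalabanImbrieJaffe1985, (4.2.1) p.310] -/
theorem mulVec_imP {ι κ : Type*} [Fintype κ] (T : Matrix ι κ ℂ) (hT : ∀ a b, (T a b).im = 0) (g : κ → ℂ) :
    T *ᵥ imP g = imP (T *ᵥ g) := by
  funext a
  simp only [imP_apply, Matrix.mulVec, dotProduct, Complex.im_sum, Complex.ofReal_sum, Complex.mul_im, hT, zero_mul,
    add_zero, Complex.ofReal_mul]
  refine Finset.sum_congr rfl fun b _ => ?_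
  rw [← Complex.re_add_im (T a b), hT]
  simp

/-- `curlC` has real (indeed `0, ±1`) entries. [cite: BalabanImbrieJaffe1985, (7.1.4) p.322] -/
theorem curlC_im {N : Fin d → ℕ} (a : Tor N × (Fin d × Fin d)) (b : Tor N × Fin d) : (curlC N a b).im = 0 := by
  simp only [curlC, Matrix.of_apply]
  split_ifs <;> simp

omit [NeZero n] hM in
/-- `Q_k` ([6I] (1.18)) has real entries `0`, `η^{d+1}`. [cite: BalabanImbrieJaffe1985, (2.13) p.304] -/
theorem QvOp_im (a : Tor M × Fin d) (b : Tor (fine n M) × Fin d) : (QvOp n M a b).im = 0 := by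
  have hr : (1 / (n : ℂ) ^ (d + 1)).im = 0 := by
    rw [show (1 / (n : ℂ) ^ (d + 1)) = (((1 / (n : ℝ) ^ (d + 1) : ℝ)) : ℂ) by push_cast; rfl, Complex.ofReal_im]
  unfold QvOp
  split_ifs
  · rw [Complex.im_sum]
    refine Finset.sum_eq_zero fun j _ => ?_
    rw [Complex.im_sum]
    refine Finset.sum_eq_zero fun t _ => ?_
    split_ifs
    · exact hr
    · rfl
  · rfl

omit hM in
/-- `Q^e_k` ((2.21)_k) has real entries `0`, `η^{d−2}`. [cite: BalabanImbrieJaffe1985, (2.21) p.305] -/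
theorem edgeAvgC_im (a : Tor M × (Fin d × Fin d)) (b : Tor (fine n M) × (Fin d × Fin d)) : (edgeAvgC n M a b).im = 0 := by
  have hr : (((n : ℂ) ^ (d - 2))⁻¹).im = 0 := by
    rw [show (((n : ℂ) ^ (d - 2))⁻¹) = (((((n : ℝ) ^ (d - 2))⁻¹ : ℝ)) : ℂ) by push_cast; rfl, Complex.ofReal_im]
  simp only [edgeAvgC, Matrix.of_apply]
  split_ifs
  · rw [Complex.im_sum]
    refine Finset.sum_eq_zero fun j _ => ?_
    split_ifs
    · exact hr
    · rfl
  · rfl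

omit hM in
/-- `Q^{e*}_k = n^d·(Q^e_k)ᴴ` ((2.22)_k) has real entries. [cite: BalabanImbrieJaffe1985, (2.22) p.305] -/
theorem edgeAdjC_im (a : Tor (fine n M) × (Fin d × Fin d)) (b : Tor M × (Fin d × Fin d)) : (edgeAdjC n M a b).im = 0 := by
  rw [edgeAdjC, Matrix.smul_apply, Matrix.conjTranspose_apply, smul_eq_mul, Complex.mul_im, Complex.star_def, Complex.conj_im,
    Complex.conj_re, edgeAvgC_im, neg_zero, mul_zero, zero_add, ← Complex.ofReal_natCast, ← Complex.ofReal_pow, Complex.ofReal_im,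
    zero_mul]

/-- `Q_k(Re A) = Re(Q_kA)`. [cite: BalabanImbrieJaffe1985, (4.2.1) p.310] -/
theorem QvOp_reP (A : Tor (fine n M) × Fin d → ℂ) : QvOp n M *ᵥ reP A = reP (QvOp n M *ᵥ A) :=
  mulVec_reP _ (QvOp_im n M) A

/-- `Q_k(Im A) = Im(Q_kA)`. [cite: BalabanImbrieJaffe1985, (4.2.1) p.310] -/
theorem QvOp_imP (A : Tor (fine n M) × Fin d → ℂ) : QvOp n M *ᵥ imP A = imP (QvOp n M *ᵥ A) :=
  mulVec_imP _ (QvOp_im n M) A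

/-- **The constraint splits**: `Q_kA = 0 ⟺ Q_k(Re A) = 0 ∧ Q_k(Im A) = 0`. [cite: BalabanImbrieJaffe1985, (4.2.1) p.310] -/
theorem QvOp_eq_zero_iff_reP_imP (A : Tor (fine n M) × Fin d → ℂ) :
    QvOp n M *ᵥ A = 0 ↔ QvOp n M *ᵥ reP A = 0 ∧ QvOp n M *ᵥ imP A = 0 := by
  rw [QvOp_reP, QvOp_imP]
  constructor
  · intro h
    rw [h]
    exact ⟨funext fun i => by simp, funext fun i => by simp⟩
  · rintro ⟨h1, h2⟩
    funext i
    have e1 := congrFun h1 i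
    have e2 := congrFun h2 i
    simp only [reP_apply, imP_apply, Pi.zero_apply, Complex.ofReal_eq_zero] at e1 e2
    exact Complex.ext e1 e2

/-- kernel: the (4.2.1) vector `n·curlC A − edgeAdjC F` of real parts is the real part of the vector. [folklore] -/
private theorem vec_reP (A : Tor (fine n M) × Fin d → ℂ) (F : Tor M × (Fin d × Fin d) → ℂ) :
    ((n : ℂ) • (curlC (fine n M) *ᵥ reP A) - edgeAdjC n M *ᵥ reP F)
      = reP (((n : ℂ) • (curlC (fine n M) *ᵥ A) - edgeAdjC n M *ᵥ F)) := by
  rw [mulVec_reP _ curlC_im, mulVec_reP _ (edgeAdjC_im n M)]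
  funext b
  simp only [Pi.sub_apply, Pi.smul_apply, smul_eq_mul, reP_apply, Complex.sub_re, Complex.mul_re, Complex.natCast_re,
    Complex.natCast_im, zero_mul, sub_zero, Complex.ofReal_sub, Complex.ofReal_mul, Complex.ofReal_natCast]

/-- kernel: the same for imaginary parts. [folklore] -/
private theorem vec_imP (A : Tor (fine n M) × Fin d → ℂ) (F : Tor M × (Fin d × Fin d) → ℂ) :
    ((n : ℂ) • (curlC (fine n M) *ᵥ imP A) - edgeAdjC n M *ᵥ imP F)
      = imP (((n : ℂ) • (curlC (fine n M) *ᵥ A) - edgeAdjC n M *ᵥ F)) := by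
  rw [mulVec_imP _ curlC_im, mulVec_imP _ (edgeAdjC_im n M)]
  funext b
  simp only [Pi.sub_apply, Pi.smul_apply, smul_eq_mul, imP_apply, Complex.sub_im, Complex.mul_im, Complex.natCast_re,
    Complex.natCast_im, zero_mul, add_zero, Complex.ofReal_sub, Complex.ofReal_mul, Complex.ofReal_natCast]

/-- **THE EXPONENT SPLITS INTO REAL AND IMAGINARY PARTS**: `E(A, F) = E(Re A, Re F) + E(Im A, Im F)` (`∂`, `Q^{e*}_k` are real).
[cite: BalabanImbrieJaffe1985, (4.2.1) p.310] -/
theorem energy421_eq_reP_add_imP (A : Tor (fine n M) × Fin d → ℂ) (F : Tor M × (Fin d × Fin d) → ℂ) :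
    energy421 n M A F = energy421 n M (reP A) (reP F) + energy421 n M (imP A) (imP F) := by
  unfold energy421
  rw [vec_reP, vec_imP, ← mul_add, ← Finset.sum_add_distrib]
  congr 1
  refine Finset.sum_congr rfl fun b _ => ?_
  rw [reP_apply, imP_apply, Complex.norm_real, Complex.norm_real, Real.norm_eq_abs, Real.norm_eq_abs, sq_abs, sq_abs,
    Complex.sq_norm, Complex.normSq_apply]
  ring

/-- For a REAL two-form `F`, discarding `Im A` does not raise the exponent: `E(Re A, F) ≤ E(A, F)`. [cite: BalabanImbrieJaffe1985, (4.2.1) p.310] -/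
theorem energy421_reP_le (A : Tor (fine n M) × Fin d → ℂ) {F : Tor M × (Fin d × Fin d) → ℂ} (hF : reP F = F) :
    energy421 n M (reP A) F ≤ energy421 n M A F := by
  have h := energy421_eq_reP_add_imP n M A F
  rw [hF] at h
  rw [h]
  exact le_add_of_nonneg_right (energy421_nonneg n M _ _)

/-- kernel: `Re(Re g) = Re g`. [folklore] -/
private theorem reP_reP {ι : Type*} (g : ι → ℂ) : reP (reP g) = reP g := by
  funext i; simp

/-- kernel: `Im F = Re(Im F)` is real. [folklore] -/
private theorem reP_imP {ι : Type*} (g : ι → ℂ) : reP (imP g) = imP g := by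
  funext i; simp

/-- kernel: real and imaginary parts of `Re B + i·Re C`. [folklore] -/
private theorem reP_imP_combine {ι : Type*} (B C : ι → ℂ) :
    reP (reP B + Complex.I • reP C) = reP B ∧ imP (reP B + Complex.I • reP C) = reP C := by
  constructor <;> funext i <;> simp

/-- **THE CONSTRAINED INFIMUM SPLITS INTO REAL AND IMAGINARY PARTS**: for every complex unit two-form `F`,
`inf_{Q_kA=0} E(A, F) = inf_{Q_kA=0} E(A, Re F) + inf_{Q_kA=0} E(A, Im F)` (real and imaginary parts of `A` are constrained separately and
contribute independently). [cite: BalabanImbrieJaffe1985, (4.2.1) p.310] -/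
theorem iInf_energy421_eq_reP_add_imP (F : Tor M × (Fin d × Fin d) → ℂ) :
    (⨅ B : {A : Tor (fine n M) × Fin d → ℂ // QvOp n M *ᵥ A = 0}, energy421 n M B.1 F)
      = (⨅ B : {A : Tor (fine n M) × Fin d → ℂ // QvOp n M *ᵥ A = 0}, energy421 n M B.1 (reP F))
        + ⨅ B : {A : Tor (fine n M) × Fin d → ℂ // QvOp n M *ᵥ A = 0}, energy421 n M B.1 (imP F) := by
  haveI : Nonempty {A : Tor (fine n M) × Fin d → ℂ // QvOp n M *ᵥ A = 0} := ⟨⟨0, Matrix.mulVec_zero _⟩⟩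
  apply le_antisymm
  · refine le_of_forall_pos_lt_add fun ε hε => ?_
    have hε2 : 0 < ε / 2 := by positivity
    obtain ⟨B, hB⟩ := exists_lt_of_ciInf_lt (lt_add_of_pos_right
      (⨅ B : {A : Tor (fine n M) × Fin d → ℂ // QvOp n M *ᵥ A = 0}, energy421 n M B.1 (reP F)) hε2)
    obtain ⟨C, hC⟩ := exists_lt_of_ciInf_lt (lt_add_of_pos_right
      (⨅ B : {A : Tor (fine n M) × Fin d → ℂ // QvOp n M *ᵥ A = 0}, energy421 n M B.1 (imP F)) hε2)
    -- the real fields `Re B`, `Re C` are constrained and at least as good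
    have hBc : QvOp n M *ᵥ reP B.1 = 0 := ((QvOp_eq_zero_iff_reP_imP n M B.1).1 B.2).1
    have hCc : QvOp n M *ᵥ reP C.1 = 0 := ((QvOp_eq_zero_iff_reP_imP n M C.1).1 C.2).1
    have hB' : energy421 n M (reP B.1) (reP F) < _ := (energy421_reP_le n M B.1 (reP_reP F)).trans_lt hB
    have hC' : energy421 n M (reP C.1) (imP F) < _ := (energy421_reP_le n M C.1 (reP_imP F)).trans_lt hC
    -- `A = Re B + i Re C`
    set A : Tor (fine n M) × Fin d → ℂ := reP B.1 + Complex.I • reP C.1 with hAdef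
    have hre : reP A = reP B.1 := (reP_imP_combine B.1 C.1).1
    have him : imP A = reP C.1 := (reP_imP_combine B.1 C.1).2
    have hA : QvOp n M *ᵥ A = 0 := by
      rw [QvOp_eq_zero_iff_reP_imP, hre, him]
      exact ⟨hBc, hCc⟩
    have hE : energy421 n M A F = energy421 n M (reP B.1) (reP F) + energy421 n M (reP C.1) (imP F) := by
      rw [energy421_eq_reP_add_imP, hre, him]
    calc (⨅ B : {A : Tor (fine n M) × Fin d → ℂ // QvOp n M *ᵥ A = 0}, energy421 n M B.1 F)
        ≤ energy421 n M A F := iInf_energy421_le n M hA F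
      _ < _ := by rw [hE]; linarith
  · refine le_ciInf fun B => ?_
    rw [energy421_eq_reP_add_imP]
    have h1 := ((QvOp_eq_zero_iff_reP_imP n M B.1).1 B.2)
    exact add_le_add (iInf_energy421_le n M h1.1 _) (iInf_energy421_le n M h1.2 _)


end

end Literature.MathematicalPhysics.QuantumFieldTheory.BalabanImbrieJaffe1984to88.BIJ85Eq7112FibreMinReal
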